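import Summits.QuantumFields.BalabanUV.Beta.D1BFx.ColumnGaugeTwoPins
import Summits.QuantumFields.BalabanUV.Beta.D1BFx.ColumnGaugeSecondOrder
import Summits.QuantumFields.BalabanUV.Beta.D1BFx.CombPairSlotLetters
import Summits.QuantumFields.BalabanUV.Beta.D1BFx.ColumnGaugeNativeFirstOrder
import Summits.QuantumFields.BalabanUV.Beta.D1BFx.ChartDefectWords
import Summits.QuantumFields.BalabanUV.Beta.CombSecondOrderClassBase
import Literature.MathematicalPhysics.QuantumFieldTheory.Balaban1983to89.Beta.StepDriftWitness

/-!
# `BalabanUV.Beta.D1BFx.ChartDefectTwoPinsRoad` — road «BF-x», binder row D1, PART 24 HEAD (H3-road) at the RECORD (`PART24-HEAD-SPEC-g24.md` v1.1 §3;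
# an2 R-D1-g45-5: «identities at both pins FIRST»): **THE ROAD's ONE-LOOP WORD AT ITS OWN PIN IS THE STRAIGHT WORD DISPLACED BY THE `Dsh`-WORDS AND THE
# Λ-SECTOR WORD ONLY** — for the literal of record at lockB (`cB = −n¹²∕4`),
# `hessKer G₀ (vertexOfK G₀ n S0) (vertex2OfK G₀ n S₂⁰) = hessKer G₀ (V^s_{S0} + G^{Dsh}) (vertex2OfK K₀ n S₂⁰ + W^{Λ} + W^{Dsh})`,
# `G₀ = coDressKBmAt ρ_c n K₀`, `K₀ = KInvStep n 0`, `V^s_{S0} = vertexOfK K₀ n S0`, `G^{Dsh} μ y = [Λc μ y, Dsh n]`, `W^{Dsh} μ y ν y′ = −[Λc ν y′, [Λc μ y, Dsh n]]`,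
# `W^{Λ} = Wmix(Λc; V^s_{S♭}) − Wmix(Λc; V^s_{S0})` (the Λ-sector's missing `Wmix`, `S0 − S♭ = cΛ•SΛ`), `Λc μ y = diagK (z b ↦ (n⁴∕2)·χ_{μ,y} (legSite ρ_c z b))`
# — leaf-01 g31's JUNCTION J1 (W-4) typed at the record: `ColumnGaugeCombPartner` §3 (first order) + leaf-01's `ColumnGaugeSecondOrder.vertex2OfK_coDressKBmAt_eq_add_Wmix_Wgg_one`
# with the record's letters `CombPairSlotLetters.hL_record ∕ hR_record ∕ hT_record` (second order) + `ColumnGaugeTwoPins.hessKer_G0bm_regroup_cancel` (the cancellation).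

HONEST DEPENDENCY (cell records, verbatim): «continuum YM on T⁴ ⇐ BetaPertH ∧ nine spine estimates (0/9 proved); BetaPertH ⇐ (D1) ∧ (D4) ∧
CAP+tail; G-an2-4 gates asym, D1 and NE2/3/4.»  HONEST FRAMING (cell contract, verbatim): «discharging `BetaPertH` makes Bałaban's UV stability
UNCONDITIONAL — a real constructive-QFT result; it is NOT the continuum limit and NOT the Clay problem.»  THIS MODULE DISCHARGES NO binder of row D1 and
NO estimate of Bałaban's: one [our object] identity between OUR kernels composed BY NAME; the colour data `Complete τ`, `TrOrthonormal τ`, `N ≠ 0` of leaf-09's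
Wilson letters are HYPOTHESES (displayed); prices NO row (the displayed words `G^{Dsh}`, `W^{Dsh}`, `W^{Λ}` are NAMED here, not bounded).  No definition,
no `def … : Prop`, nothing cited, 0 sorry.  0∕4 row-D1 binders; (K) NOT closed; (J1) ONE OPEN ROW; NOT D1, NEVER «G-an2-4 closed», NOT `BetaPertH`, NOT continuum, NOT Clay.

ABSOLUTE RULE (cell charter, verbatim): «No internally-minted statement may enter as a cited fact. Every hypothesis is either kernel-proved in this
package or a verbatim quotation of a PUBLISHED theorem with page reference. The manuscript(s) under audit are NOT citable for their own disputed
steps — they are the thing under adjudication; programme-internal (2001/route/tribunal) claims are never citable.»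

Unit `b2b-balaban-beta-d1-p2` (road owner, gen 24), 2026-08-23; no existing file touched.
-/

noncomputable section

namespace Summit.QuantumFields.BalabanUV.Beta.D1BFx.ChartDefectTwoPinsRoad

open Literature.MathematicalPhysics.QuantumFieldTheory
open Literature.MathematicalPhysics.QuantumFieldTheory.LatticeForm (quo)
open Literature.MathematicalPhysics.QuantumFieldTheory.Balaban1983to89
open Literature.MathematicalPhysics.QuantumFieldTheory.Balaban1983to89.Beta
open B4ContourShift (supNorm)
open ColourTrace (Complete TrOrthonormal)
open WilsonVertex2Sym (wsym22)
open WilsonBiStencil (wilsonW₂)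
open StepJetData (wilsonA)
open ExpKernelCalculus (MKer comp hessKer tadpole)
open OneStepResolventKernel (Fib LocStencil)
open OneStepKernelFamily (colH vertexOfK KInvStep)
open SecondOrderResponse (vertex2OfK)
open BalabanCompositeJets (LocStencil₂)
open AffineAveraging (Site box toSite)
open AveragingContoursRooted (ctr ctrOff ctrOff_mem_box)
open Summit.QuantumFields.BalabanUV.Beta.TameKernelCalculus (Spr Loc)
open Summit.QuantumFields.BalabanUV.Beta.BorderedHessian (diagK bhK spr_KInvStep)
open Summit.QuantumFields.BalabanUV.Beta.DshAn1 (Dsh spr_Dsh)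
open Summit.QuantumFields.BalabanUV.Beta.AxialDressingRooted (coDressKBmAt axEc)
open Summit.QuantumFields.BalabanUV.Beta.AxialProjectorBlockMean (bmGaugeAt)
open Summit.QuantumFields.BalabanUV.Beta.AveragingWardRootedStencils (legSite)
open Summit.QuantumFields.BalabanUV.Beta.SymAveragingHessianCounts (symVhSAt)
open Summit.QuantumFields.BalabanUV.Beta.SymSecondOrderTablesAn1 (symVh₂SAn1 symTablesAn1S2)
open Summit.QuantumFields.BalabanUV.Beta.CombChartStepJets (JsB12CombSh0)
open Summit.QuantumFields.BalabanUV.Beta.SpineRooted (T2RecOf_zero_level)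
open Summit.QuantumFields.BalabanUV.Beta.CombSecondOrderClassBase (locStencil₂_T2RecOf_symTablesAn1)
open Summit.QuantumFields.BalabanUV.Beta.D1BFx.RawStencilSupportRows (locStencil_JsB12CombSh0_S_zero_of_decays locStencil_pure_zero)
open Summit.QuantumFields.BalabanUV.Beta.D1BFx.PackedColumnEnvelope (abs_colH_KInvStep_zero_le)
open Summit.QuantumFields.BalabanUV.Beta.D1BFx.DressedVertexSplit (abs_bmGaugeAt_weight_le)
open Summit.QuantumFields.BalabanUV.Beta.D1BFx.ColumnGaugeGenerator (comp_generator_axEc_comm)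
open Summit.QuantumFields.BalabanUV.Beta.D1BFx.ColumnGaugeNativeFirstOrder (loc_diagK_weight_legSite)
open Summit.QuantumFields.BalabanUV.Beta.D1BFx.ColumnGaugeCombPartner (vertexOfK_G0bm_S_zero_eq_add_comm)
open Summit.QuantumFields.BalabanUV.Beta.D1BFx.ColumnGaugeSecondOrder (vertex2OfK_coDressKBmAt_eq_add_Wmix_Wgg_one)
open Summit.QuantumFields.BalabanUV.Beta.D1BFx.CombPairSlotLetters (hL_record hR_record hT_record)
open Summit.QuantumFields.BalabanUV.Beta.D1BFx.ColumnGaugeTwoPins (hessKer_G0bm_regroup_cancel)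
open Summit.QuantumFields.BalabanUV.Beta.D1BFx.ChartDefectWords (loc_vertexOfK_of_spr loc_vertex2OfK_of_spr)
open Summit.QuantumFields.BalabanUV.Beta.KernelWardRelative (loc_zero)
open StepDriftWitness (tadpole_zero)
open B5Hk163Strip (kappa163 kappa163_pos)
open B5Hk163Decay (MG163)
open B4TorusKernel (periodConst)

variable {n : ℕ} [NeZero n] {N : ℕ} {C : Type*} [Fintype C] [DecidableEq C] {τ : C → Matrix (Fin N) (Fin N) ℂ}

/-- **THE ROAD's WORD AT ITS OWN PIN, GAUGE WORDS CANCELLED** [our object] (the (H3-road) identity at the literal of record, lockB `cB = −n¹²∕4`):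
with `G₀ := coDressKBmAt ρ_c n (KInvStep n 0)`, `K₀ := KInvStep n 0`, `S0`, `S₂⁰`, `S♭` the record's tables and `Λc μ y := diagK (z b ↦ (n⁴∕2)·χ_{μ,y} (legSite ρ_c z b))`,
`χ_{μ,y} := bmGaugeAt ρ_c (colH K₀ n μ y) n`,
`hessKer G₀ (vertexOfK G₀ n S0) (vertex2OfK G₀ n S₂⁰) μ ν z = hessKer G₀ (μ y ↦ vertexOfK K₀ n S0 μ y + [Λc μ y, Dsh n])
 (μ y ν y′ ↦ (vertex2OfK K₀ n S₂⁰ μ y ν y′ + W^{Λ} μ y ν y′) − [Λc ν y′, [Λc μ y, Dsh n]]) μ ν z`,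
`W^{Λ} := Wmix(Λc; vertexOfK K₀ n S♭) − Wmix(Λc; vertexOfK K₀ n S0)` — every other gauge word of the dressed vertices cancels by
`ColumnGaugeTwoPins.hessKer_G0bm_regroup_cancel` (`RelInv G₀ bhK axEc`). -/
theorem hessKer_G0bm_record_eq (hodd : Odd n) (hτ : Complete τ) (ho : TrOrthonormal τ) (hN : N ≠ 0) (c : C) (cΛ : ℝ)
    (μ ν : Fin 4) (z : Site 4) :
    hessKer (coDressKBmAt (ctr 4 n) n (KInvStep (d := 3) n 0))
        (vertexOfK (coDressKBmAt (ctr 4 n) n (KInvStep (d := 3) n 0)) n (JsB12CombSh0 hodd N (symTablesAn1S2 3 n cΛ) cΛ (-((n : ℝ) ^ 12 / 4)) 0).S)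
        (vertex2OfK (coDressKBmAt (ctr 4 n) n (KInvStep (d := 3) n 0)) n
          (fun κ u κ' u' => ((n : ℝ) ^ 8) • wilsonW₂ 3 ((8 * (N : ℝ) ^ 2)⁻¹ • wsym22 N) κ u κ' u' + (-((n : ℝ) ^ 12 / 4)) • symVh₂SAn1 3 n κ u κ' u'))
        μ ν z
      = hessKer (coDressKBmAt (ctr 4 n) n (KInvStep (d := 3) n 0))
        (fun μ' y => vertexOfK (KInvStep (d := 3) n 0) n (JsB12CombSh0 hodd N (symTablesAn1S2 3 n cΛ) cΛ (-((n : ℝ) ^ 12 / 4)) 0).S μ' y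
          + (comp (diagK fun z' b => (n : ℝ) ^ 4 / 2 * bmGaugeAt (ctr 4 n) (colH (KInvStep (d := 3) n 0) n μ' y) n (legSite (ctr 4 n) z' b)) (Dsh n)
              - comp (Dsh n) (diagK fun z' b => (n : ℝ) ^ 4 / 2 * bmGaugeAt (ctr 4 n) (colH (KInvStep (d := 3) n 0) n μ' y) n (legSite (ctr 4 n) z' b))))
        (fun μ' y ν' y' =>
          (vertex2OfK (KInvStep (d := 3) n 0) n
              (fun κ u κ' u' => ((n : ℝ) ^ 8) • wilsonW₂ 3 ((8 * (N : ℝ) ^ 2)⁻¹ • wsym22 N) κ u κ' u' + (-((n : ℝ) ^ 12 / 4)) • symVh₂SAn1 3 n κ u κ' u') μ' y ν' y'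
            + ((((comp (diagK fun z' b => (n : ℝ) ^ 4 / 2 * bmGaugeAt (ctr 4 n) (colH (KInvStep (d := 3) n 0) n ν' y') n (legSite (ctr 4 n) z' b))
                      (vertexOfK (KInvStep (d := 3) n 0) n (fun κ u => ((n : ℝ) ^ 4) • wilsonA 3 κ u + (-((n : ℝ) ^ 8 / 2)) • symVhSAt (ctr 4 n) 3 n rfl κ u) μ' y)
                    - comp (vertexOfK (KInvStep (d := 3) n 0) n (fun κ u => ((n : ℝ) ^ 4) • wilsonA 3 κ u + (-((n : ℝ) ^ 8 / 2)) • symVhSAt (ctr 4 n) 3 n rfl κ u) μ' y)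
                      (diagK fun z' b => (n : ℝ) ^ 4 / 2 * bmGaugeAt (ctr 4 n) (colH (KInvStep (d := 3) n 0) n ν' y') n (legSite (ctr 4 n) z' b)))
                  + (comp (diagK fun z' b => (n : ℝ) ^ 4 / 2 * bmGaugeAt (ctr 4 n) (colH (KInvStep (d := 3) n 0) n μ' y) n (legSite (ctr 4 n) z' b))
                      (vertexOfK (KInvStep (d := 3) n 0) n (fun κ u => ((n : ℝ) ^ 4) • wilsonA 3 κ u + (-((n : ℝ) ^ 8 / 2)) • symVhSAt (ctr 4 n) 3 n rfl κ u) ν' y')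
                    - comp (vertexOfK (KInvStep (d := 3) n 0) n (fun κ u => ((n : ℝ) ^ 4) • wilsonA 3 κ u + (-((n : ℝ) ^ 8 / 2)) • symVhSAt (ctr 4 n) 3 n rfl κ u) ν' y')
                      (diagK fun z' b => (n : ℝ) ^ 4 / 2 * bmGaugeAt (ctr 4 n) (colH (KInvStep (d := 3) n 0) n μ' y) n (legSite (ctr 4 n) z' b))))
              - ((comp (diagK fun z' b => (n : ℝ) ^ 4 / 2 * bmGaugeAt (ctr 4 n) (colH (KInvStep (d := 3) n 0) n ν' y') n (legSite (ctr 4 n) z' b))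
                      (vertexOfK (KInvStep (d := 3) n 0) n (JsB12CombSh0 hodd N (symTablesAn1S2 3 n cΛ) cΛ (-((n : ℝ) ^ 12 / 4)) 0).S μ' y)
                    - comp (vertexOfK (KInvStep (d := 3) n 0) n (JsB12CombSh0 hodd N (symTablesAn1S2 3 n cΛ) cΛ (-((n : ℝ) ^ 12 / 4)) 0).S μ' y)
                      (diagK fun z' b => (n : ℝ) ^ 4 / 2 * bmGaugeAt (ctr 4 n) (colH (KInvStep (d := 3) n 0) n ν' y') n (legSite (ctr 4 n) z' b)))
                  + (comp (diagK fun z' b => (n : ℝ) ^ 4 / 2 * bmGaugeAt (ctr 4 n) (colH (KInvStep (d := 3) n 0) n μ' y) n (legSite (ctr 4 n) z' b))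
                      (vertexOfK (KInvStep (d := 3) n 0) n (JsB12CombSh0 hodd N (symTablesAn1S2 3 n cΛ) cΛ (-((n : ℝ) ^ 12 / 4)) 0).S ν' y')
                    - comp (vertexOfK (KInvStep (d := 3) n 0) n (JsB12CombSh0 hodd N (symTablesAn1S2 3 n cΛ) cΛ (-((n : ℝ) ^ 12 / 4)) 0).S ν' y')
                      (diagK fun z' b => (n : ℝ) ^ 4 / 2 * bmGaugeAt (ctr 4 n) (colH (KInvStep (d := 3) n 0) n μ' y) n (legSite (ctr 4 n) z' b)))))))
          - (comp (diagK fun z' b => (n : ℝ) ^ 4 / 2 * bmGaugeAt (ctr 4 n) (colH (KInvStep (d := 3) n 0) n ν' y') n (legSite (ctr 4 n) z' b))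
                (comp (diagK fun z' b => (n : ℝ) ^ 4 / 2 * bmGaugeAt (ctr 4 n) (colH (KInvStep (d := 3) n 0) n μ' y) n (legSite (ctr 4 n) z' b)) (Dsh n)
                  - comp (Dsh n) (diagK fun z' b => (n : ℝ) ^ 4 / 2 * bmGaugeAt (ctr 4 n) (colH (KInvStep (d := 3) n 0) n μ' y) n (legSite (ctr 4 n) z' b)))
              - comp (comp (diagK fun z' b => (n : ℝ) ^ 4 / 2 * bmGaugeAt (ctr 4 n) (colH (KInvStep (d := 3) n 0) n μ' y) n (legSite (ctr 4 n) z' b)) (Dsh n)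
                  - comp (Dsh n) (diagK fun z' b => (n : ℝ) ^ 4 / 2 * bmGaugeAt (ctr 4 n) (colH (KInvStep (d := 3) n 0) n μ' y) n (legSite (ctr 4 n) z' b)))
                (diagK fun z' b => (n : ℝ) ^ 4 / 2 * bmGaugeAt (ctr 4 n) (colH (KInvStep (d := 3) n 0) n ν' y') n (legSite (ctr 4 n) z' b))))
        μ ν z := by
  -- abbreviations
  set K₀ : MKer (3 + 1) (Fib 3) := KInvStep (d := 3) n 0 with hK₀def
  set S0 := (JsB12CombSh0 hodd N (symTablesAn1S2 3 n cΛ) cΛ (-((n : ℝ) ^ 12 / 4)) 0).S with hS0def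
  set Sfl : Fin (3 + 1) → Site (3 + 1) → MKer (3 + 1) (Fib 3) :=
    fun κ u => ((n : ℝ) ^ 4) • wilsonA 3 κ u + (-((n : ℝ) ^ 8 / 2)) • symVhSAt (ctr 4 n) 3 n rfl κ u with hSfldef
  set S₂ : Fin (3 + 1) → Site (3 + 1) → Fin (3 + 1) → Site (3 + 1) → MKer (3 + 1) (Fib 3) :=
    fun κ u κ' u' => ((n : ℝ) ^ 8) • wilsonW₂ 3 ((8 * (N : ℝ) ^ 2)⁻¹ • wsym22 N) κ u κ' u' + (-((n : ℝ) ^ 12 / 4)) • symVh₂SAn1 3 n κ u κ' u' with hS₂def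
  set Λc : Fin (3 + 1) → Site (3 + 1) → MKer (3 + 1) (Fib 3) :=
    fun μ' y => diagK fun z' b => (n : ℝ) ^ 4 / 2 * bmGaugeAt (ctr 4 n) (colH K₀ n μ' y) n (legSite (ctr 4 n) z' b) with hΛcdef
  have hn1 : 1 ≤ n := Nat.one_le_iff_ne_zero.2 (NeZero.ne n)
  -- structural facts about the straight kernel and the record's tables
  have hK₀ : Spr K₀ := spr_KInvStep (d := 3) (Lc := n) 0
  have hKdec : ∃ δ C : ℝ, 0 < δ ∧ 0 ≤ C ∧ ExpKernelCalculus.Decays K₀ C δ := OneStepKernelFamily.decays_KInvStep (Lc := n) (d := 3) 0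
  obtain ⟨δK, CK, hδK, hCK, hKd⟩ := OneStepResolventKernel.decays_KInv (N := n) (d := 3)
  obtain ⟨Cs, -, hS⟩ := locStencil_JsB12CombSh0_S_zero_of_decays hodd N (symTablesAn1S2 3 n cΛ) cΛ (-((n : ℝ) ^ 12 / 4)) hKd hCK hδK
  obtain ⟨Cfl, -, hSfl⟩ := locStencil_pure_zero (n := n) (symTablesAn1S2 3 n cΛ) (δ := 1) zero_le_one
  obtain ⟨C₂, δ₂, hδ₂, hS₂⟩ := locStencil₂_T2RecOf_symTablesAn1 (Lc := n) N cΛ 0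
  rw [T2RecOf_zero_level] at hS₂
  have hC₂ : 0 ≤ C₂ := hS₂.nonneg
  -- g53's block envelope of the straight column (both bonds)
  have hcol : ∀ (μ' : Fin (3 + 1)) (y : Site (3 + 1)) (κ : Fin (3 + 1)) (u : Site (3 + 1)), |colH K₀ n μ' y κ u|
      ≤ ((n : ℝ) ^ (3 + 2))⁻¹ * (MG163 (3 + 1) * periodConst (kappa163 (3 + 1)) 3)
          * Real.exp (-(kappa163 (3 + 1) / ((3 : ℝ) + 1) * supNorm (quo n u - y))) :=
    fun μ' y κ u => abs_colH_KInvStep_zero_le (d := 3) (N := n) hn1 μ' y κ u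
  have hM : 0 ≤ ((n : ℝ) ^ (3 + 2))⁻¹ * (MG163 (3 + 1) * periodConst (kappa163 (3 + 1)) 3) :=
    (mul_nonneg_iff_of_pos_right (Real.exp_pos _)).1 ((abs_nonneg _).trans (hcol 0 0 0 0))
  have hc : 0 < kappa163 (3 + 1) / ((3 : ℝ) + 1) := div_pos (kappa163_pos (3 + 1)) (by positivity)
  -- the generator is localised and commutes with the slice projector
  have hΛ : ∀ μ' y, Loc (Λc μ' y) := fun μ' y => by
    have hn0 : (0 : ℝ) < n := by exact_mod_cast hn1
    have hχ := abs_bmGaugeAt_weight_le hn1 (ctrOff_mem_box hn1) K₀ μ' y hM hc.le (hcol μ' y)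
    exact loc_diagK_weight_legSite (by positivity) (by positivity) hχ (ctr 4 n) ((n : ℝ) ^ 4 / 2)
  have hΛE : ∀ μ' y, comp (Λc μ' y) (axEc (ctr (3 + 1) n) n) = comp (axEc (ctr (3 + 1) n) n) (Λc μ' y) :=
    fun μ' y => comp_generator_axEc_comm _ _ _
  -- localisation of the straight families
  have hV : ∀ μ' y, Loc (vertexOfK K₀ n S0 μ' y) := fun μ' y => loc_vertexOfK_of_spr hK₀ hS (half_pos hδK) μ' y
  have hVfl : ∀ μ' y, Loc (vertexOfK K₀ n Sfl μ' y) := fun μ' y => loc_vertexOfK_of_spr hK₀ hSfl one_pos μ' y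
  have hW2 : ∀ μ' y ν' y', Loc (vertex2OfK K₀ n S₂ μ' y ν' y') := fun μ' y ν' y' => loc_vertex2OfK_of_spr hK₀ hS₂ hC₂ hδ₂ μ' y ν' y'
  -- FIRST ORDER: `V^{bm} = V^s + [Λc, bhK + Dsh]` (ColumnGaugeCombPartner §3)
  have eV : vertexOfK (coDressKBmAt (ctr 4 n) n K₀) n S0 = fun μ' y => vertexOfK K₀ n S0 μ' y + (comp (Λc μ' y) (bhK n + Dsh n) - comp (bhK n + Dsh n) (Λc μ' y)) :=
    funext fun μ' => funext fun y => vertexOfK_G0bm_S_zero_eq_add_comm hodd N cΛ (-((n : ℝ) ^ 12 / 4)) μ' y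
  -- SECOND ORDER: leaf-01's one-table identity with the record's three letters
  have eW : vertex2OfK (coDressKBmAt (ctr 4 n) n K₀) n S₂ = fun μ' y ν' y' =>
      (vertex2OfK K₀ n S₂ μ' y ν' y'
        + (((comp (Λc ν' y') (vertexOfK K₀ n Sfl μ' y) - comp (vertexOfK K₀ n Sfl μ' y) (Λc ν' y'))
            + (comp (Λc μ' y) (vertexOfK K₀ n Sfl ν' y') - comp (vertexOfK K₀ n Sfl ν' y') (Λc μ' y)))
          - ((comp (Λc ν' y') (vertexOfK K₀ n S0 μ' y) - comp (vertexOfK K₀ n S0 μ' y) (Λc ν' y'))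
            + (comp (Λc μ' y) (vertexOfK K₀ n S0 ν' y') - comp (vertexOfK K₀ n S0 ν' y') (Λc μ' y)))))
      + ((((comp (Λc ν' y') (vertexOfK K₀ n S0 μ' y) - comp (vertexOfK K₀ n S0 μ' y) (Λc ν' y'))
            + (comp (Λc μ' y) (vertexOfK K₀ n S0 ν' y') - comp (vertexOfK K₀ n S0 ν' y') (Λc μ' y)))
          + (comp (Λc μ' y) (comp (Λc ν' y') (bhK n + Dsh n) - comp (bhK n + Dsh n) (Λc ν' y'))
              - comp (comp (Λc ν' y') (bhK n + Dsh n) - comp (bhK n + Dsh n) (Λc ν' y')) (Λc μ' y)))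
        + (0 : MKer (3 + 1) (Fib 3))) := by
    funext μ' y ν' y'
    have h := vertex2OfK_coDressKBmAt_eq_add_Wmix_Wgg_one hn1 (ctrOff_mem_box hn1) hKdec hS₂ hδ₂ μ' y ν' y' hM hc (hcol μ' y) (hcol ν' y')
      (S := Sfl) (𝕄 := bhK n + Dsh n) (ρ := ctr 4 n) (ξ := (n : ℝ) ^ 4 / 2)
      (fun κ' u' w => hL_record (n := n) hτ ho hN c κ' u' w) (fun α x w' => hR_record (n := n) hτ ho hN c α x w')
      (fun w' => hT_record hodd N cΛ (-((n : ℝ) ^ 12 / 4)) w')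
    rw [show toSite (ctrOff (3 + 1) n) = ctr 4 n from rfl] at h
    rw [h, add_zero]
    abel
  -- the cancellation at the road's pin
  rw [eV, eW]
  exact hessKer_G0bm_regroup_cancel (Lc := n) (d := 3) hV hΛ hΛE
    (fun μ' y ν' y' => (hW2 μ' y ν' y').add
      (((((hΛ ν' y').comp (hVfl μ' y)).sub ((hVfl μ' y).comp (hΛ ν' y'))).add
          (((hΛ μ' y).comp (hVfl ν' y')).sub ((hVfl ν' y').comp (hΛ μ' y)))).sub
        ((((hΛ ν' y').comp (hV μ' y)).sub ((hV μ' y).comp (hΛ ν' y'))).add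
          (((hΛ μ' y).comp (hV ν' y')).sub ((hV ν' y').comp (hΛ μ' y))))))
    (fun _ _ _ _ => loc_zero) (fun _ _ _ _ => tadpole_zero _) μ ν z

end Summit.QuantumFields.BalabanUV.Beta.D1BFx.ChartDefectTwoPinsRoad

end
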